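import Summits.CriticalPhenomena.CardyFormulaZ2.Theorems.CardyMagicRigidityNestingRigidityNeckZ2SkeletonArms
import HarnessLib

/-!
# Crux `NestingRigidity`, line `pinch-resampling` (v4), stub S12: the parameters of the necklace summation and the degenerate scale

Crux `Summit.CriticalPhenomena.CardyFormulaZ2.Theses.CardyMagicRigidity.NestingRigidity`
(stmt-CriticalPhenomena-4835), line `pinch-resampling` v4, stub S12 `stub_neckHookupCoarseZ2 : NeckHookupCoarseZ2`.
Plumbing brick of the summation of the necklace bound `ZNodeAbsBoundChainA` (recipe in the module docstring of
`…NeckZ2SkeletonCovering`; worker W6a):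

* `zNodeEventChainA_zero` — at scale `s = 0` the necklace node event is empty (the collar `Λ_0 ∖ Λ_0` has no inner
  layer); this disposes of the degenerate case `lam = 0` of the window `s³ℓ ≤ lam⁴`.
* `cells_param` — `Nc := (8 (s+1) + ℓ - 1)/ℓ` satisfies `(Nc - 1) ℓ < 8 (s + 1) ≤ Nc ℓ` (`ℓ ≥ 1`).
* `arm_params` (registered anchor `skeleton_arm_params`) — with `Jz := (3 log₂ L - 3)/K` and `R₀ := lam / 2^{K Jz + 1}`
  (`L ≥ 2`, `L³ ℓ ≤ lam`; any `K`): `4 ℓ ≤ R₀` (so `R₀ ≥ max 2 ℓ`) and `2 · armROut R₀ K z ≤ lam` for every `z < Jz` —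
  the hypotheses of `chainA_skeleton_covering` / `chainA_union_bound` on the arm scales.
-/

noncomputable section

namespace Summit.CriticalPhenomena.CardyFormulaZ2.Cruxes.NestingRigidity.PinchResampling

open MeasureTheory Set Literature.Probability.Percolation Literature.Probability.LatticeModels
open ZPinchLocality

/-- **At scale `s = 0` the necklace node event is empty.** -/
theorem zNodeEventChainA_zero (ℓ lam : ℕ) (x o : Site 2) : ZNodeEventChainA ℓ lam 0 x o = ∅ := by
  ext ω
  simp only [mem_empty_iff_false, iff_false]
  rintro ⟨F, b, b', rk, inP, outP, -, -, hb, -⟩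
  obtain ⟨⟨⟨hbO, hbI⟩, -⟩, -⟩ := hb
  exact hbI (by simpa using hbO)

/-- **The number of cells**: `Nc := (8 (s + 1) + ℓ - 1) / ℓ` has `(Nc - 1) ℓ < 8 (s + 1) ≤ Nc ℓ`. -/
theorem cells_param {ℓ : ℕ} (hℓ : 1 ≤ ℓ) (s : ℕ) :
    8 * ((s : ℤ) + 1) ≤ (((8 * (s + 1) + ℓ - 1) / ℓ : ℕ) : ℤ) * ℓ ∧
      ((((8 * (s + 1) + ℓ - 1) / ℓ : ℕ) : ℤ) - 1) * (ℓ : ℤ) < 8 * ((s : ℤ) + 1) := by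
  set Nc := (8 * (s + 1) + ℓ - 1) / ℓ with hNc
  have h1 : Nc * ℓ ≤ 8 * (s + 1) + ℓ - 1 := Nat.div_mul_le_self _ _
  have h2 : 8 * (s + 1) + ℓ - 1 < Nc * ℓ + ℓ := Nat.lt_div_mul_add (by omega)
  set P := Nc * ℓ with hP
  have hlow : 8 * (s + 1) ≤ P := by omega
  have hup : P ≤ 8 * (s + 1) + ℓ - 1 := h1
  constructor
  · have : ((8 * (s + 1) : ℕ) : ℤ) ≤ ((P : ℕ) : ℤ) := by exact_mod_cast hlow
    push_cast at this
    rw [hP] at this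
    push_cast at this
    linarith
  · have : ((P : ℕ) : ℤ) + 1 ≤ ((8 * (s + 1) + ℓ : ℕ) : ℤ) := by exact_mod_cast (by omega : P + 1 ≤ 8 * (s + 1) + ℓ)
    push_cast at this
    rw [hP] at this
    push_cast at this
    nlinarith

/-- **The arm scales**: with `Jz := (3 log₂ L - 3)/K`, `R₀ := lam / 2^{K Jz + 1}`: `4 ℓ ≤ R₀` and
`2 · armROut R₀ K z ≤ lam` for `z < Jz` (`L ≥ 2`, `L³ ℓ ≤ lam`). -/
theorem arm_params {ℓ lam L K : ℕ} (hL : 2 ≤ L) (hlam : L ^ 3 * ℓ ≤ lam) :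
    4 * ℓ ≤ lam / 2 ^ (K * ((3 * Nat.log 2 L - 3) / K) + 1) ∧
      ∀ z < (3 * Nat.log 2 L - 3) / K,
        2 * Necklace.armROut (lam / 2 ^ (K * ((3 * Nat.log 2 L - 3) / K) + 1)) K z ≤ lam := by
  set Jz := (3 * Nat.log 2 L - 3) / K with hJz
  set R₀ := lam / 2 ^ (K * Jz + 1) with hR₀
  have hKJ : K * Jz ≤ 3 * Nat.log 2 L - 3 := by
    rw [hJz, mul_comm]
    exact Nat.div_mul_le_self _ _
  -- `2^{K Jz + 1} · 4 ≤ L³`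
  have hlog : 2 ^ Nat.log 2 L ≤ L := Nat.pow_log_le_self 2 (by omega)
  have hlog1 : 1 ≤ Nat.log 2 L := Nat.log_pos one_lt_two hL
  have hpow : 2 ^ (K * Jz + 1) * 4 ≤ L ^ 3 := by
    calc 2 ^ (K * Jz + 1) * 4 = 2 ^ (K * Jz + 3) := by ring
      _ ≤ 2 ^ (3 * Nat.log 2 L) := Nat.pow_le_pow_right (by norm_num) (by omega)
      _ = (2 ^ Nat.log 2 L) ^ 3 := by rw [← pow_mul, mul_comm]
      _ ≤ L ^ 3 := Nat.pow_le_pow_left hlog 3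
  have hpos : 0 < 2 ^ (K * Jz + 1) := by positivity
  constructor
  · -- `4 ℓ · 2^{KJz+1} ≤ L³ ℓ ≤ lam`
    rw [hR₀, Nat.le_div_iff_mul_le hpos]
    calc 4 * ℓ * 2 ^ (K * Jz + 1) = 2 ^ (K * Jz + 1) * 4 * ℓ := by ring
      _ ≤ L ^ 3 * ℓ := Nat.mul_le_mul_right _ hpow
      _ ≤ lam := hlam
  · intro z hz
    have hRlam : R₀ * 2 ^ (K * Jz + 1) ≤ lam := Nat.div_mul_le_self _ _
    have hmono : 2 ^ (K * (z + 1)) ≤ 2 ^ (K * Jz) := Nat.pow_le_pow_right (by norm_num) (by nlinarith)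
    simp only [Necklace.armROut]
    have h1 : R₀ * 2 ^ (K * (z + 1)) ≤ R₀ * 2 ^ (K * Jz) := Nat.mul_le_mul_left _ hmono
    have h2 : 2 * (R₀ * 2 ^ (K * Jz)) = R₀ * 2 ^ (K * Jz + 1) := by ring
    omega

/-- **Arm scales of the necklace summation (registered helper, anchor of this module on the crux item)**: for `L ≥ 2`,
`L³ ℓ ≤ lam` and any `K`, the choices `Jz := (3 log₂ L - 3)/K`, `R₀ := lam / 2^{K Jz + 1}` give `4 ℓ ≤ R₀` and
`2 armROut R₀ K z ≤ lam` on the `Jz` slots (`arm_params`); and `ZNodeEventChainA ℓ lam 0 x o = ∅`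
(`zNodeEventChainA_zero`). -/
theorem skeleton_arm_params : ∀ (ℓ lam L K : ℕ), 2 ≤ L → L ^ 3 * ℓ ≤ lam → (4 * ℓ ≤ lam / 2 ^ (K * ((3 * Nat.log 2 L - 3) / K) + 1) ∧ ∀ z < (3 * Nat.log 2 L - 3) / K, 2 * Necklace.armROut (lam / 2 ^ (K * ((3 * Nat.log 2 L - 3) / K) + 1)) K z ≤ lam) ∧ ∀ (x o : Site 2), ZNodeEventChainA ℓ lam 0 x o = ∅ :=
  fun ℓ lam _ _ hL hlam ↦ ⟨arm_params hL hlam, fun x o ↦ zNodeEventChainA_zero ℓ lam x o⟩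

end Summit.CriticalPhenomena.CardyFormulaZ2.Cruxes.NestingRigidity.PinchResampling

end
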